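import Mathlib
import HarnessLib
import Summits.HubbardSuperconductivity.HubbardSuperconductivity.Theorems.ComplexGFFStiffnessHypACumulantHolomorphicAssembly

/-!
# Crux `HypACumulant`, line `gnv` — (C3d′) assembly, intermediate norm `‖·‖_{k:k+1}` and continuity of the
# weights of a weight tower

Route `route-HubbardSuperconductivity-ComplexGFFStiffness`, cruxes stmt-HubbardSuperconductivity-19154 /
-19155, shared research statement `OnePointLipschitz`, census (C3d′) (memo §8).  Companion of
`…HolomorphicAssembly`: the `MidNormLE` ([ABKM19] (6.49)) twins of the pointwise-holomorphy Lipschitz and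
parallelogram bounds, and the continuity of the weights `w_k^X`, `w_{k:k+1}^X` of ANY weight tower
(`WeightData.weight/midWeight = exp(½(φ, A φ))`; `continuous_towerWeight`, `continuous_towerMidWeight`), which discharges the weight-continuity hypothesis of both
assembly theorems for the torus data.  All proved, no `sorry`.

## References
* S. Adams, S. Buchholz, R. Kotecký, S. Müller, arXiv:1910.13564, Ch. 6.4 (6.49), Ch. 7.1 (7.4)
  [AdamsBuchholzKoteckyMuller2019].
-/

noncomputable section

-- `Summit.<Summit>.<Problem>`: single-conjunct summit, the duplicate component is mandated (D-0017).
set_option linter.dupNamespace false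

namespace Summit.HubbardSuperconductivity.HubbardSuperconductivity.Theorems.ComplexGFF

open Metric Set Filter Topology
open Literature.MathematicalPhysics.StatisticalMechanics.GradientRG
open Literature.MathematicalPhysics.StatisticalMechanics.TorusPolymer (IsPolymer)
open Literature.Barriers.CriticalPhenomena.LongRangePhi4.Polymer (IsConn)

section Weights

variable {Λ : Type*} [Fintype Λ] [DecidableEq Λ]

/-- the weights `w_k^X(φ) = exp(½(φ, A_k^X φ))` of a weight tower are continuous in the field. -/
theorem continuous_towerWeight (W : Literature.MathematicalPhysics.StatisticalMechanics.GradientRG.WeightData Λ) (k : ℕ) (X : Finset Λ) :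
    Continuous (W.weight k X) := by
  unfold WeightData.weight
  fun_prop

/-- the intermediate weights `w_{k:k+1}^X` are continuous in the field. -/
theorem continuous_towerMidWeight (W : Literature.MathematicalPhysics.StatisticalMechanics.GradientRG.WeightData Λ) (k : ℕ) (X : Finset Λ) :
    Continuous (W.midWeight k X) := by
  unfold WeightData.midWeight
  fun_prop

end Weights

section PolymerMid

variable {d M : ℕ} [NeZero M]

/-- **Intermediate norm `‖·‖_{k:k+1}`: `‖K_σ − K_0‖ ≤ (r₀+1)(2C/R)|σ|` from pointwise holomorphy, per-`σ` smoothness,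
continuous weights and a uniform bound on the disc.** -/
theorem midNormLE_sub_of_pointwise_holomorphic (P : NormParams d M) (k : ℕ)
    (hw : ∀ X, Continuous (P.W.midWeight k X))
    {K : ℂ → Finset (Fin d → ZMod M) → ((Fin d → ZMod M) → ℝ) → ℂ} {R C : ℝ}
    (hhol : ∀ X ψ, DifferentiableOn ℂ (fun σ => K σ X ψ) (ball (0 : ℂ) R))
    (hKc : ∀ σ ∈ ball (0 : ℂ) R, ∀ X, ContDiff ℝ (P.r₀ : WithTop ℕ∞) (K σ X))
    (hC : ∀ σ ∈ ball (0 : ℂ) R, MidNormLE P k (K σ) C) {σ : ℂ} (hσ : σ ∈ ball (0 : ℂ) R) :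
    MidNormLE P k (fun X ψ => K σ X ψ - K 0 X ψ) (((P.r₀ : ℝ) + 1) * (2 * C / R) * ‖σ‖) := by
  classical
  have hR : 0 < R := lt_of_le_of_lt (norm_nonneg σ) (mem_ball_zero_iff.mp hσ)
  have h0 : (0 : ℂ) ∈ ball (0 : ℂ) R := mem_ball_self hR
  -- modify the family outside the disc (irrelevant for the conclusion) to have global smoothness
  set K' : ℂ → Finset (Fin d → ZMod M) → ((Fin d → ZMod M) → ℝ) → ℂ :=
    fun σ' => if σ' ∈ ball (0 : ℂ) R then K σ' else K 0 with hK'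
  have hK'eq : ∀ σ' ∈ ball (0 : ℂ) R, K' σ' = K σ' := fun σ' hσ' => by
    show (if σ' ∈ ball (0 : ℂ) R then K σ' else K 0) = K σ'
    rw [if_pos hσ']
  have hK'c : ∀ σ' X, ContDiff ℝ (P.r₀ : WithTop ℕ∞) (gaugeLift (P.gauge k X) (K' σ' X)) := by
    intro σ' X
    by_cases h : σ' ∈ ball (0 : ℂ) R
    · rw [hK'eq σ' h]; exact contDiff_gaugeLift _ (hKc σ' h X)
    · have : K' σ' = K 0 := by
        show (if σ' ∈ ball (0 : ℂ) R then K σ' else K 0) = K 0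
        rw [if_neg h]
      rw [this]; exact contDiff_gaugeLift _ (hKc 0 h0 X)
  have hC' : ∀ σ' ∈ ball (0 : ℂ) R, MidNormLE P k (K' σ') C := fun σ' hσ' => by rw [hK'eq σ' hσ']; exact hC σ' hσ'
  intro X hX hXc φ
  have hT : ∀ σ' ∈ ball (0 : ℂ) R, TayNormLE (P.gauge k X) P.r₀ (P.W.midWeight k X) (K' σ' X) (C * P.aFactor k X) :=
    fun σ' hσ' => hC' σ' hσ' X hX hXc
  have hhol' : ∀ ψ, DifferentiableOn ℂ (fun σ' => K' σ' X ψ) (ball (0 : ℂ) R) :=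
    fun ψ => (hhol X ψ).congr (fun σ' hσ' => by simp only [hK'eq σ' hσ'])
  have hcoef : ∀ s : ℕ, s ≤ P.r₀ → ∀ v : Fin s → LinearMap.range (P.gauge k X),
      DifferentiableOn ℂ (fun σ' => iteratedFDeriv ℝ s (gaugeLift (P.gauge k X) (K' σ' X))
        ((P.gauge k X).rangeRestrict φ) v) (ball (0 : ℂ) R) :=
    fun s hs' v => coeff_holomorphic_of_pointwise isOpen_ball (P.gauge k X) (hw X) (K := fun σ' => K' σ' X)
      hhol' (fun σ' hσ' => by rw [hK'eq σ' hσ']; exact hKc σ' hσ' X) hT s hs' _ v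
  have h := tayNorm_sub_le_of_holomorphic_coeff (P.gauge k X) P.r₀ (K := fun σ' ψ => K' σ' X ψ)
    (M := C * P.aFactor k X * P.W.midWeight k X φ) (fun σ' => hK'c σ' X) φ hcoef
    (fun σ' hσ' => by have := hT σ' hσ' φ; simpa [mul_assoc] using this) hσ
  have eσ : K' σ X = K σ X := by rw [hK'eq σ hσ]
  have e0 : K' 0 X = K 0 X := by rw [hK'eq 0 h0]
  simp only [eσ, e0] at h
  calc tayNorm (P.gauge k X) P.r₀ (fun ψ => K σ X ψ - K 0 X ψ) φ
      ≤ ((P.r₀ : ℝ) + 1) * (2 * (C * P.aFactor k X * P.W.midWeight k X φ) / R) * ‖σ‖ := h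
    _ = ((P.r₀ : ℝ) + 1) * (2 * C / R) * ‖σ‖ * P.aFactor k X * P.W.midWeight k X φ := by ring

/-- **Intermediate norm, parallelogram bound** from pointwise (separate) holomorphy, per-parameter smoothness,
continuous weights and a uniform bound on the bidisc. -/
theorem midNormLE_secondDiff_of_pointwise_holomorphic (P : NormParams d M) (k : ℕ)
    (hw : ∀ X, Continuous (P.W.midWeight k X))
    {K : ℂ → ℂ → Finset (Fin d → ZMod M) → ((Fin d → ZMod M) → ℝ) → ℂ} {R C : ℝ}
    (hholσ : ∀ τ ∈ ball (0 : ℂ) R, ∀ X ψ, DifferentiableOn ℂ (fun σ => K σ τ X ψ) (ball (0 : ℂ) R))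
    (hholτ : ∀ σ ∈ ball (0 : ℂ) R, ∀ X ψ, DifferentiableOn ℂ (fun τ => K σ τ X ψ) (ball (0 : ℂ) R))
    (hKc : ∀ σ ∈ ball (0 : ℂ) R, ∀ τ ∈ ball (0 : ℂ) R, ∀ X, ContDiff ℝ (P.r₀ : WithTop ℕ∞) (K σ τ X))
    (hC : ∀ σ ∈ ball (0 : ℂ) R, ∀ τ ∈ ball (0 : ℂ) R, MidNormLE P k (K σ τ) C)
    {σ τ : ℂ} (hσ : σ ∈ ball (0 : ℂ) R) (hτ : τ ∈ ball (0 : ℂ) R) :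
    MidNormLE P k (fun X ψ => K σ τ X ψ - K σ 0 X ψ - K 0 τ X ψ + K 0 0 X ψ)
      (((P.r₀ : ℝ) + 1) * (4 * C / R ^ 2) * ‖σ‖ * ‖τ‖) := by
  classical
  have hR : 0 < R := lt_of_le_of_lt (norm_nonneg σ) (mem_ball_zero_iff.mp hσ)
  have h0 : (0 : ℂ) ∈ ball (0 : ℂ) R := mem_ball_self hR
  -- modify the family outside the bidisc
  set K' : ℂ → ℂ → Finset (Fin d → ZMod M) → ((Fin d → ZMod M) → ℝ) → ℂ :=
    fun σ' τ' => if σ' ∈ ball (0 : ℂ) R ∧ τ' ∈ ball (0 : ℂ) R then K σ' τ' else K 0 0 with hK'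
  have hK'eq : ∀ σ' ∈ ball (0 : ℂ) R, ∀ τ' ∈ ball (0 : ℂ) R, K' σ' τ' = K σ' τ' :=
    fun σ' hσ' τ' hτ' => by
      show (if σ' ∈ ball (0 : ℂ) R ∧ τ' ∈ ball (0 : ℂ) R then K σ' τ' else K 0 0) = K σ' τ'
      rw [if_pos ⟨hσ', hτ'⟩]
  have hK'c : ∀ σ' τ' X, ContDiff ℝ (P.r₀ : WithTop ℕ∞) (gaugeLift (P.gauge k X) (K' σ' τ' X)) := by
    intro σ' τ' X
    by_cases h : σ' ∈ ball (0 : ℂ) R ∧ τ' ∈ ball (0 : ℂ) R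
    · rw [hK'eq σ' h.1 τ' h.2]; exact contDiff_gaugeLift _ (hKc σ' h.1 τ' h.2 X)
    · have : K' σ' τ' = K 0 0 := by
        show (if σ' ∈ ball (0 : ℂ) R ∧ τ' ∈ ball (0 : ℂ) R then K σ' τ' else K 0 0) = K 0 0
        rw [if_neg h]
      rw [this]; exact contDiff_gaugeLift _ (hKc 0 h0 0 h0 X)
  intro X hX hXc φ
  have hT : ∀ σ' ∈ ball (0 : ℂ) R, ∀ τ' ∈ ball (0 : ℂ) R,
      TayNormLE (P.gauge k X) P.r₀ (P.W.midWeight k X) (K' σ' τ' X) (C * P.aFactor k X) :=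
    fun σ' hσ' τ' hτ' => by rw [hK'eq σ' hσ' τ' hτ']; exact hC σ' hσ' τ' hτ' X hX hXc
  have hcoefσ : ∀ s : ℕ, s ≤ P.r₀ → ∀ v : Fin s → LinearMap.range (P.gauge k X), ∀ τ' ∈ ball (0 : ℂ) R,
      DifferentiableOn ℂ (fun σ' => iteratedFDeriv ℝ s (gaugeLift (P.gauge k X) (K' σ' τ' X))
        ((P.gauge k X).rangeRestrict φ) v) (ball (0 : ℂ) R) := by
    intro s hs' v τ' hτ'
    refine coeff_holomorphic_of_pointwise isOpen_ball (P.gauge k X) (hw X) (K := fun σ' => K' σ' τ' X)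
      (fun ψ => (hholσ τ' hτ' X ψ).congr (fun σ' hσ' => by simp only [hK'eq σ' hσ' τ' hτ']))
      (fun σ' hσ' => by rw [hK'eq σ' hσ' τ' hτ']; exact hKc σ' hσ' τ' hτ' X) (fun σ' hσ' => hT σ' hσ' τ' hτ') s hs' _ v
  have hcoefτ : ∀ s : ℕ, s ≤ P.r₀ → ∀ v : Fin s → LinearMap.range (P.gauge k X), ∀ σ' ∈ ball (0 : ℂ) R,
      DifferentiableOn ℂ (fun τ' => iteratedFDeriv ℝ s (gaugeLift (P.gauge k X) (K' σ' τ' X))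
        ((P.gauge k X).rangeRestrict φ) v) (ball (0 : ℂ) R) := by
    intro s hs' v σ' hσ'
    refine coeff_holomorphic_of_pointwise isOpen_ball (P.gauge k X) (hw X) (K := fun τ' => K' σ' τ' X)
      (fun ψ => (hholτ σ' hσ' X ψ).congr (fun τ' hτ' => by simp only [hK'eq σ' hσ' τ' hτ']))
      (fun τ' hτ' => by rw [hK'eq σ' hσ' τ' hτ']; exact hKc σ' hσ' τ' hτ' X) (fun τ' hτ' => hT σ' hσ' τ' hτ') s hs' _ v
  have h := tayNorm_secondDiff_le_of_holomorphic_coeff (P.gauge k X) P.r₀ (K := fun σ' τ' ψ => K' σ' τ' X ψ)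
    (M := C * P.aFactor k X * P.W.midWeight k X φ) (fun σ' τ' => hK'c σ' τ' X) φ hcoefσ hcoefτ
    (fun σ' hσ' τ' hτ' => by have := hT σ' hσ' τ' hτ' φ; simpa [mul_assoc] using this) hσ hτ
  have e1 : K' σ τ X = K σ τ X := by rw [hK'eq σ hσ τ hτ]
  have e2 : K' σ 0 X = K σ 0 X := by rw [hK'eq σ hσ 0 h0]
  have e3 : K' 0 τ X = K 0 τ X := by rw [hK'eq 0 h0 τ hτ]
  have e4 : K' 0 0 X = K 0 0 X := by rw [hK'eq 0 h0 0 h0]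
  simp only [e1, e2, e3, e4] at h
  calc tayNorm (P.gauge k X) P.r₀ (fun ψ => K σ τ X ψ - K σ 0 X ψ - K 0 τ X ψ + K 0 0 X ψ) φ
      ≤ ((P.r₀ : ℝ) + 1) * (4 * (C * P.aFactor k X * P.W.midWeight k X φ) / R ^ 2) * ‖σ‖ * ‖τ‖ := h
    _ = ((P.r₀ : ℝ) + 1) * (4 * C / R ^ 2) * ‖σ‖ * ‖τ‖ * P.aFactor k X * P.W.midWeight k X φ := by ring

end PolymerMid

end Summit.HubbardSuperconductivity.HubbardSuperconductivity.Theorems.ComplexGFF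

end
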